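import Literature.AlgebraicGeometry.AbelianSchemes.AbelianSchemeOverRingAction        -- ★ `RingAction` (`i_add`, `i_one`, `i_mul`, `i_nsmul`)
import Literature.AlgebraicGeometry.Motives.AbelianVarietyTorsionCotangent            -- ★ DEAL 2 p846488: `nsmul_id_hom_eq_mulN`
import Literature.RingTheory.DedekindDomain.BlockIdempotentFamily                    -- ★ (O-CRT) p846342: `sub_mem_span_pow`
import HarnessLib

/-!
# The cotangent action of a ring action factors through `O ∕ p` in characteristic `p`: the Lie-signature socket (S-T) is independent of `n`

Topic `Literature/AlgebraicGeometry/AbelianSchemes`; namespace `Literature.AlgebraicGeometry.AbelianSchemes.AbelianSchemeOver.RingAction`.  THEOREMS ONLY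
(no definition, no named fact, no instance, no notation, no `sorry`).  Cell `hodgecm-mathlib` (D-0151), P6 «MOD programme», K∕BT cut v2.3, socket (S-T) plumbing
(B-p12 (g32) offer 19:57Z): the hypothesis `hsig : ∀ n, 0 < n → dim range (cotangentMap A (act.i (a n))) = 1` of ★ DEAL 6 `htan_hdim_block_of_lieSignature` and of
the line `Cruxes/HLiu418/Lines/F0_P6d_BlockDocking.lean` ED. 6 reduces to ONE Kottwitz count, because `a_n ≡ a_1 (mod p)` and the action of `O` on
`𝔪_{A,e} ∕ 𝔪_{A,e}²` kills `p` in characteristic `p`.  HC_CM is proved only modulo the printed citations (2 remaining named inputs hLiu418, h413) until rung 0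
closes; count-neutral.

THE PRINT.  [Kottwitz1992] §5 (p. 390): `ι : O → End(A)` a ring homomorphism acting on `Lie(A)`; the determinant ∕ signature condition at a point of
characteristic `p` only sees the action mod `p`.  [GortzWedhorn2023] Remark 27.18 (3) (p. 611): `T_e` is additive on `Hom(A, A)` and `T_e([n]) = n` — so
`r ↦ (act.i r)^*` is additive `O → End_k(𝔪_e ∕ 𝔪_e²)` with `p ↦ p = 0`, i.e. it factors through `O ∕ pO`.  With a block idempotent family
`a_{n+1} ≡ a_n (mod pⁿ)` ([Neukirch1999] Ch. I §3 (3.6); ★ (O-CRT)), `(act.i (a n))^* = (act.i (a 1))^*` for all `n ≥ 1`.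

DESIGN.  Endomorphisms of the abelian variety `A := 𝒜.toAffine.toAbelianVariety` enter as VARIABLES `u : A ⟶ A` pinned by `u.hom.hom.hom = act.i r` (so that
`+`, `≫`, `n • 𝟙` are those of ★ `Motives.AbelianVariety`); the socket statements are then read at `u := InducedCategory.homMk (Grp.ofHom (act.i r))` (the
spelling of ★ DEAL 6 and of ED. 6), whose pin is `rfl`.

WHAT IS HERE: §1 `cotangentMap_eq_add_of_hom_eq` ∕ `cotangentMap_eq_comp_of_hom_eq` ∕ `cotangentMap_eq_natCast_smul_of_hom_eq` (additivity,
multiplicativity, `(ι N)^* = N`); §2 **`cotangentMap_eq_of_hom_eq_of_sub_mem_span`** (`[CharP k p]`, `r − s ∈ (p)` ⇒ `(ι r)^* = (ι s)^*`); §3 for a block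
idempotent family: `blockIdempotent_sub_one_mem_span` (`a_n ≡ a_1 (p)`), **`cotangentMap_i_blockIdempotent_eq`**, and the socket forms **`hsig_of_congr`**
(from any lift `b ≡ a_1 (p)`) ∕ **`hsig_of_one`** (from `n = 1`), conclusion = the `hsig` binder of ★ `htan_hdim_block_of_lieSignature` VERBATIM.

## References
* [Kottwitz1992] R. Kottwitz, *Points on some Shimura varieties over finite fields*, JAMS 5 (1992) — §5 (p. 390).
* [GortzWedhorn2023] U. Görtz, T. Wedhorn, *Algebraic Geometry II* (2023) — Remark 27.18 (3) (p. 611).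
* [Neukirch1999] J. Neukirch, *Algebraic Number Theory* (1999) — Ch. I §3 (3.6).
-/

set_option autoImplicit false

noncomputable section

universe u v

open CategoryTheory CategoryTheory.Limits AlgebraicGeometry MonoidalCategory CartesianMonoidalCategory
open scoped MonObj

namespace Literature.AlgebraicGeometry.AbelianSchemes

namespace AbelianSchemeOver

namespace RingAction

open Literature.AlgebraicGeometry.Motives Literature.AlgebraicGeometry.Motives.AbelianVariety Literature.RingTheory.DedekindDomain

variable {k : Type u} [Field k] {𝒜 : AbelianSchemeOver (Spec (.of k))} {O : Type v} [CommRing O] (act : RingAction O 𝒜)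

/-! ## §1 The cotangent action is additive, multiplicative, and `(ι N)^* = N` -/

/-- **Additivity on `𝔪_e ∕ 𝔪_e²`**: if `u, v, w` are the endomorphisms `ι(r), ι(s), ι(r + s)` of the abelian variety, then `w = u + v` and
`w^* = u^* + v^*` (★ `i_add`, ★ `cotangentMap_add`: `T_e` is additive). [cite: GortzWedhorn2023, Remark 27.18 (3) (p. 611)] -/
theorem cotangentMap_eq_add_of_hom_eq {r s : O} {u v w : 𝒜.toAffine.toAbelianVariety ⟶ 𝒜.toAffine.toAbelianVariety}
    (hu : u.hom.hom.hom = act.i r) (hv : v.hom.hom.hom = act.i s) (hw : w.hom.hom.hom = act.i (r + s)) :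
    AbelianVariety.cotangentMap 𝒜.toAffine.toAbelianVariety w =
      AbelianVariety.cotangentMap 𝒜.toAffine.toAbelianVariety u + AbelianVariety.cotangentMap 𝒜.toAffine.toAbelianVariety v := by
  have h : w = u + v := by
    apply AbelianVariety.hom_ext
    rw [hw, act.i_add]
    change _ = u.hom.hom.hom * v.hom.hom.hom
    rw [hu, hv]
    rfl
  rw [h, AbelianVariety.cotangentMap_add]

/-- **Multiplicativity**: if `u, v, w` are `ι(c), ι(d), ι(c d)`, then `w = v ≫ u` and `w^* = v^* ∘ u^*` (★ `i_mul`, ★ `cotangentMap_comp`).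
[cite: Kottwitz1992, §5 (p. 390)] -/
theorem cotangentMap_eq_comp_of_hom_eq {c d : O} {u v w : 𝒜.toAffine.toAbelianVariety ⟶ 𝒜.toAffine.toAbelianVariety}
    (hu : u.hom.hom.hom = act.i c) (hv : v.hom.hom.hom = act.i d) (hw : w.hom.hom.hom = act.i (c * d)) :
    AbelianVariety.cotangentMap 𝒜.toAffine.toAbelianVariety w =
      AbelianVariety.cotangentMap 𝒜.toAffine.toAbelianVariety v ∘ₗ AbelianVariety.cotangentMap 𝒜.toAffine.toAbelianVariety u := by
  have h : w = v ≫ u := by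
    apply AbelianVariety.hom_ext
    rw [hw, act.i_mul]
    change _ = v.hom.hom.hom ≫ u.hom.hom.hom
    rw [hu, hv]
    rfl
  rw [h, AbelianVariety.cotangentMap_comp]

/-- **`(ι N)^* = N` on `𝔪_e ∕ 𝔪_e²`**: the endomorphism `ι(N)` is `[N] = N • 𝟙` (★ `i_nsmul`, `i_one`, ★ `nsmul_id_hom_eq_mulN`) and `[N]^* = N`.
[cite: GortzWedhorn2023, Remark 27.18 (3) (p. 611)] -/
theorem cotangentMap_eq_natCast_smul_of_hom_eq [IsCommMonObj 𝒜.X] (N : ℕ) {u : 𝒜.toAffine.toAbelianVariety ⟶ 𝒜.toAffine.toAbelianVariety}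
    (hu : u.hom.hom.hom = act.i (N : O)) :
    AbelianVariety.cotangentMap 𝒜.toAffine.toAbelianVariety u = (N : k) • LinearMap.id := by
  have h : u = N • 𝟙 𝒜.toAffine.toAbelianVariety := by
    apply AbelianVariety.hom_ext
    rw [hu, nsmul_id_hom_eq_mulN, mulN_def, ← nsmul_one, act.i_nsmul, act.i_one]
  rw [h, AbelianVariety.cotangentMap_nsmul, AbelianVariety.cotangentMap_id, Nat.cast_smul_eq_nsmul]

/-! ## §2 The cotangent action factors through `O ∕ p` in characteristic `p` -/

/-- **`r ≡ s (mod p)` ⇒ `(ι r)^* = (ι s)^*` on `𝔪_e ∕ 𝔪_e²` in characteristic `p`**: `ι(r) = ι(s) + ι(c p)` with `(ι(c p))^* = (ι p)^* ∘ (ι c)^* = p · (ι c)^* = 0`.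
[cite: Kottwitz1992, §5 (p. 390)] [cite: GortzWedhorn2023, Remark 27.18 (3) (p. 611)] -/
theorem cotangentMap_eq_of_hom_eq_of_sub_mem_span [IsCommMonObj 𝒜.X] {p : ℕ} [CharP k p] {r s : O} (h : r - s ∈ Ideal.span {(p : O)})
    {u v : 𝒜.toAffine.toAbelianVariety ⟶ 𝒜.toAffine.toAbelianVariety} (hu : u.hom.hom.hom = act.i r) (hv : v.hom.hom.hom = act.i s) :
    AbelianVariety.cotangentMap 𝒜.toAffine.toAbelianVariety u = AbelianVariety.cotangentMap 𝒜.toAffine.toAbelianVariety v := by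
  obtain ⟨c, hc⟩ := Ideal.mem_span_singleton'.mp h
  haveI := act.isMonHom_i (c * (p : O)); haveI := act.isMonHom_i c; haveI := act.isMonHom_i (p : O)
  -- `r = s + c p`
  have hr : r = s + c * (p : O) := by rw [hc]; ring
  -- `(ι r)^* = (ι s)^* + (ι (c p))^*` and `(ι (c p))^* = (ι p)^* ∘ (ι c)^* = 0`
  have e1 := act.cotangentMap_eq_add_of_hom_eq (u := v)
    (v := InducedCategory.homMk (Grp.ofHom (A := 𝒜.X) (B := 𝒜.X) (act.i (c * (p : O))))) (w := u) hv rfl (by rw [hu, hr])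
  have e2 := act.cotangentMap_eq_comp_of_hom_eq (c := c) (d := (p : O))
    (u := InducedCategory.homMk (Grp.ofHom (A := 𝒜.X) (B := 𝒜.X) (act.i c)))
    (v := InducedCategory.homMk (Grp.ofHom (A := 𝒜.X) (B := 𝒜.X) (act.i (p : O))))
    (w := InducedCategory.homMk (Grp.ofHom (A := 𝒜.X) (B := 𝒜.X) (act.i (c * (p : O))))) rfl rfl rfl
  have e3 := act.cotangentMap_eq_natCast_smul_of_hom_eq p (u := InducedCategory.homMk (Grp.ofHom (A := 𝒜.X) (B := 𝒜.X) (act.i (p : O)))) rfl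
  rw [e1, e2, e3, CharP.cast_eq_zero, zero_smul, LinearMap.zero_comp, add_zero]

/-! ## §3 Block idempotent families: `(ι a_n)^* = (ι a_1)^*`, so socket (S-T) needs ONE count -/

variable {p : ℕ} {w 𝔟 : Ideal O} {e : ℕ} (hx : Ideal.span {(p : O)} = w ^ e * 𝔟) (hcop : w ⊔ 𝔟 = ⊤)
  (a : ℕ → O) (ha1 : ∀ n, a n - 1 ∈ w ^ (e * n)) (ha2 : ∀ n, a n ∈ 𝔟 ^ n)

include hx hcop ha1 ha2 in
omit act in
/-- `a_n ≡ a_1 (mod p)` for every `n ≥ 1` (★ `sub_mem_span_pow`: `a_{m+1} ≡ a_m (mod p^m)`, and `(p^m) ⊆ (p)` for `m ≥ 1`). [cite: Neukirch1999, Ch. I §3 (3.6)] -/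
theorem blockIdempotent_sub_one_mem_span (n : ℕ) (hn : 0 < n) : a n - a 1 ∈ Ideal.span {(p : O)} := by
  induction n with
  | zero => exact absurd hn (lt_irrefl 0)
  | succ m ih =>
    rcases Nat.eq_zero_or_pos m with rfl | hm
    · rw [sub_self]; exact Ideal.zero_mem _
    · have h1 : a (m + 1) - a m ∈ Ideal.span {(p : O)} :=
        Ideal.span_singleton_le_span_singleton.mpr (dvd_pow_self (p : O) hm.ne') (sub_mem_span_pow hx hcop ha1 ha2 m)
      have h2 : a (m + 1) - a 1 = (a (m + 1) - a m) + (a m - a 1) := by ring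
      rw [h2]
      exact Ideal.add_mem _ h1 (ih hm)

include hx hcop ha1 ha2 in
/-- **`(ι a_n)^* = (ι a_1)^*` on `𝔪_e ∕ 𝔪_e²`** for a block idempotent family in characteristic `p`, `n ≥ 1` (the spelling of ★ `htan_hdim_block_of_lieSignature`'s `hsig`).
[cite: Kottwitz1992, §5 (p. 390)] -/
theorem cotangentMap_i_blockIdempotent_eq [IsCommMonObj 𝒜.X] [CharP k p] (n : ℕ) (hn : 0 < n) :
    (haveI := act.isMonHom_i (a n);
      AbelianVariety.cotangentMap 𝒜.toAffine.toAbelianVariety (InducedCategory.homMk (Grp.ofHom (A := 𝒜.X) (B := 𝒜.X) (act.i (a n))))) =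
      (haveI := act.isMonHom_i (a 1);
        AbelianVariety.cotangentMap 𝒜.toAffine.toAbelianVariety (InducedCategory.homMk (Grp.ofHom (A := 𝒜.X) (B := 𝒜.X) (act.i (a 1))))) :=
  haveI := act.isMonHom_i (a n); haveI := act.isMonHom_i (a 1)
  act.cotangentMap_eq_of_hom_eq_of_sub_mem_span (blockIdempotent_sub_one_mem_span hx hcop a ha1 ha2 n hn) rfl rfl

include hx hcop ha1 ha2 in
/-- **SOCKET (S-T) FROM ANY LIFT `b` OF `e_w mod p`**: if `b ≡ a_1 (mod p)` and `(ι b)^*` has rank `1` on `𝔪_e ∕ 𝔪_e²`, then `hsig` holds for every `n ≥ 1` — the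
binder of ★ `htan_hdim_block_of_lieSignature` ∕ ED. 6 `F0_P6d_BlockDocking`, verbatim. [cite: Kottwitz1992, §5 (p. 390)] -/
theorem hsig_of_congr [IsCommMonObj 𝒜.X] [CharP k p] (b : O) (hb : b - a 1 ∈ Ideal.span {(p : O)})
    (h : haveI := act.isMonHom_i b;
      Module.finrank k (LinearMap.range (AbelianVariety.cotangentMap 𝒜.toAffine.toAbelianVariety
        (InducedCategory.homMk (Grp.ofHom (A := 𝒜.X) (B := 𝒜.X) (act.i b))))) = 1) :
    ∀ n, 0 < n → haveI := act.isMonHom_i (a n);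
      Module.finrank k (LinearMap.range (AbelianVariety.cotangentMap 𝒜.toAffine.toAbelianVariety
        (InducedCategory.homMk (Grp.ofHom (A := 𝒜.X) (B := 𝒜.X) (act.i (a n)))))) = 1 := by
  intro n hn
  haveI := act.isMonHom_i (a n); haveI := act.isMonHom_i b
  have e1 := act.cotangentMap_i_blockIdempotent_eq hx hcop a ha1 ha2 n hn
  have e2 := act.cotangentMap_eq_of_hom_eq_of_sub_mem_span hb
    (u := InducedCategory.homMk (Grp.ofHom (A := 𝒜.X) (B := 𝒜.X) (act.i b)))
    (v := haveI := act.isMonHom_i (a 1); InducedCategory.homMk (Grp.ofHom (A := 𝒜.X) (B := 𝒜.X) (act.i (a 1)))) rfl rfl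
  rw [e1, ← e2]
  exact h

include hx hcop ha1 ha2 in
/-- **SOCKET (S-T) FROM ONE COUNT**: `hsig` at `n = 1` gives `hsig` for all `n ≥ 1`. [cite: Kottwitz1992, §5 (p. 390)] -/
theorem hsig_of_one [IsCommMonObj 𝒜.X] [CharP k p]
    (h1 : haveI := act.isMonHom_i (a 1);
      Module.finrank k (LinearMap.range (AbelianVariety.cotangentMap 𝒜.toAffine.toAbelianVariety
        (InducedCategory.homMk (Grp.ofHom (A := 𝒜.X) (B := 𝒜.X) (act.i (a 1)))))) = 1) :
    ∀ n, 0 < n → haveI := act.isMonHom_i (a n);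
      Module.finrank k (LinearMap.range (AbelianVariety.cotangentMap 𝒜.toAffine.toAbelianVariety
        (InducedCategory.homMk (Grp.ofHom (A := 𝒜.X) (B := 𝒜.X) (act.i (a n)))))) = 1 :=
  act.hsig_of_congr hx hcop a ha1 ha2 (a 1) (by rw [sub_self]; exact Ideal.zero_mem _) h1

end RingAction

end AbelianSchemeOver

end Literature.AlgebraicGeometry.AbelianSchemes

end
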